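import Summits.QuantumAdvantage.AdviceFreeQNC0.AffBells22FrameJunta
import Summits.QuantumAdvantage.AdviceFreeQNC0.AffBells22SpanPhi
import Summits.QuantumAdvantage.AdviceFreeQNC0.KernelFibrationMoves
import HarnessLib

/-!
# Cell qa-qnc0, FRAME AVERAGING (ROUND-21 §4.7): the EXACT frame-averaging identity and the domination inequality —
planner qa-qnc0-p1 g22 ask P-22g, step 2 ("the frame-averaging identity behind `FrameAveragingOne`")

Support for crux `RingDenseResidualLt3` (stmt-QuantumAdvantage-22907), route `DWalkThree`.  For a frame ⊗ junta strategy
`z_k(x) = τ_k(Vx, x)` and its frozen strategies `z^{[u]}_k(x) = τ_k(u, x)` (`AffBells22FrameJunta`), on the odd class the win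
indicator is `[WIN(z,x)] = (1 − (−1)^{⟨J(x), stake(z,x)⟩})/2` (`Fib19.rel_iff_stake`, `win_indicator_eq`) and `z(x) = z^{[Vx]}(x)`;
Fourier inversion on `𝔽₃^m` in the frame variable (`AffBells22.fourier_inversion`) then gives, for EVERY frame `V` and EVERY
table `τ` (`N ≥ 3`), the kit-certified identity (j301659):

* **`frame_averaging_identity`**:
  `winCount(z) = 3^{−m} Σ_u winCount(z^{[u]}) − ½ Σ_{t ≠ 0} Σ_{x odd} Ĝ_x(t) ω^{⟨t, Vx⟩}`,
  `Ĝ_x(t) = 3^{−m} Σ_u (−1)^{⟨J(x), stake(z^{[u]},x)⟩} ω^{−⟨t,u⟩}` (`fhat m (frozenSign τ x) t`);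
* **`frame_domination`**: `winCount(z) ≤ (Σ_u winCount(z^{[u]}))/3^m + ½ Σ_{t≠0} ‖Σ_{x odd} Ĝ_x(t) ω^{⟨t,Vx⟩}‖`.

So `FrameAveraging(One)` is reduced to bounding the `3^m − 1` error sums `Σ_{x odd} Ĝ_x(t) ω^{⟨t,Vx⟩}`, `t ≠ 0` (fibrewise:
product-times-character sums over the coins, then `KernelZerosOnSetMGF`-type decay along `supp(tV)`).

WHAT THIS IS NOT: no bound on the error sums (hence neither `FrameAveragingOne` nor `FrameAveraging` is proved here); nothing
touches the crux.
-/

namespace Summit.QuantumAdvantage.AdviceFreeQNC0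

open Finset Literature.Computability.QuantumComplexity Literature.Computability.QuantumComplexity.RingHLF
open Literature.Computability.MetaComplexity

namespace AffBells22

variable {N m : ℕ}

/-! ## The win indicator as a sign -/

/-- The fibre sign of the frozen strategy `z^{[u]}` at `x`: `(−1)^{⟨J(x), stake(z^{[u]}, x)⟩}`. -/
noncomputable def frozenSign (τ : Fin N → (Fin m → ZMod 3) → (Fin N → Bool) → Bool) (x : Fin N → Bool)
    (u : Fin m → ZMod 3) : ℂ :=
  (-1 : ℂ) ^ dot2 (Fib19.kline x) (Fib19.stake (frozenBell τ u) x)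

/-- On the odd class, `[WIN(z, x)] = (1 − (−1)^{⟨J(x), stake(z,x)⟩})/2` (as a complex number). -/
theorem win_indicator_eq (hN : 3 ≤ N) (z : (Fin N → Bool) → Fin N → Bool) (x : Fin N → Bool) (hx : Fib19.IsOdd x) :
    (if RingHLF.Rel x (z x) then (1 : ℂ) else 0) = (1 - (-1 : ℂ) ^ dot2 (Fib19.kline x) (Fib19.stake z x)) / 2 := by
  have hiff := Fib19.rel_iff_stake hN z x hx
  by_cases hr : RingHLF.Rel x (z x)
  · rw [if_pos hr, hiff.mp hr]; norm_num
  · rw [if_neg hr]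
    have hd : dot2 (Fib19.kline x) (Fib19.stake z x) ≠ 1 := fun h => hr (hiff.mpr h)
    have hd0 : dot2 (Fib19.kline x) (Fib19.stake z x) = 0 := by
      unfold dot2 at hd ⊢; omega
    rw [hd0]; norm_num

/-- The frame ⊗ junta strategy is the frozen strategy at the frame value: `z(x) = z^{[Vx]}(x)`. -/
theorem frameJuntaBell_eq_frozen (V : Fin m → Fin N → ZMod 3) (τ : Fin N → (Fin m → ZMod 3) → (Fin N → Bool) → Bool)
    (x : Fin N → Bool) : frameJuntaBell V τ x = frozenBell τ (frameVal V x) x := rfl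

/-- The stake depends on the strategy only through its value at `x`. -/
theorem stake_frameJuntaBell (V : Fin m → Fin N → ZMod 3) (τ : Fin N → (Fin m → ZMod 3) → (Fin N → Bool) → Bool)
    (x : Fin N → Bool) : Fib19.stake (frameJuntaBell V τ) x = Fib19.stake (frozenBell τ (frameVal V x)) x := by
  funext k
  unfold Fib19.stake
  rfl

/-- `winCount` as a sum of indicators over the odd class (complex form). -/
theorem winCount_eq_sum (z : (Fin N → Bool) → Fin N → Bool) :
    ((winCount z : ℕ) : ℂ)
      = ∑ x ∈ (univ : Finset (Fin N → Bool)).filter (fun x => Fib19.IsOdd x),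
          (if RingHLF.Rel x (z x) then (1 : ℂ) else 0) := by
  classical
  unfold winCount
  rw [Finset.sum_ite, sum_const_zero, add_zero, sum_const, nsmul_eq_mul, mul_one, Finset.filter_filter]
  congr 1
  congr 1
  refine Finset.filter_congr fun x _ => ?_
  rw [Fib19.isOdd_iff_oddZeros]

/-! ## The frame-averaging identity -/

/-- **THE FRAME-AVERAGING IDENTITY** (exact; Fourier inversion on `𝔽₃^m` in the frame variable):
`winCount(z) = 3^{−m} Σ_u winCount(z^{[u]}) − ½ Σ_{t ≠ 0} Σ_{x odd} Ĝ_x(t) ω^{⟨t, Vx⟩}`,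
`Ĝ_x(t) = 3^{−m} Σ_u (−1)^{⟨J(x), stake(z^{[u]}, x)⟩} ω^{−⟨t,u⟩}`, for EVERY frame `V` and EVERY table `τ` (`N ≥ 3`). -/
theorem frame_averaging_identity (hN : 3 ≤ N) (V : Fin m → Fin N → ZMod 3)
    (τ : Fin N → (Fin m → ZMod 3) → (Fin N → Bool) → Bool) :
    ((winCount (frameJuntaBell V τ) : ℕ) : ℂ)
      = (∑ u : Fin m → ZMod 3, ((winCount (frozenBell τ u) : ℕ) : ℂ)) / (3 : ℂ) ^ m
        - (1 / 2) * ∑ t ∈ (univ : Finset (Fin m → ZMod 3)).erase 0,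
            ∑ x ∈ (univ : Finset (Fin N → Bool)).filter (fun x => Fib19.IsOdd x),
              fhat m (frozenSign τ x) t * (ZMod.stdAddChar (∑ l : Fin m, t l * frameVal V x l) : ℂ) := by
  have h3 : ((3 : ℂ) ^ m) ≠ 0 := pow_ne_zero _ (by norm_num)
  -- left-hand side: indicators, then the sign at the frame value, then Fourier inversion
  rw [winCount_eq_sum]
  have hL : ∀ x ∈ (univ : Finset (Fin N → Bool)).filter (fun x => Fib19.IsOdd x),
      (if RingHLF.Rel x (frameJuntaBell V τ x) then (1 : ℂ) else 0)
        = 1 / 2 - (1 / 2) * ∑ t : Fin m → ZMod 3,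
            fhat m (frozenSign τ x) t * (ZMod.stdAddChar (∑ l : Fin m, t l * frameVal V x l) : ℂ) := by
    intro x hx
    have hodd : Fib19.IsOdd x := (mem_filter.mp hx).2
    rw [win_indicator_eq hN _ x hodd, stake_frameJuntaBell]
    have hF := fourier_inversion (frozenSign τ x) (frameVal V x)
    unfold frozenSign at hF ⊢
    rw [← hF]
    ring
  rw [sum_congr rfl hL]
  -- right-hand side: the frozen counts
  have hR : ∀ u : Fin m → ZMod 3, ((winCount (frozenBell τ u) : ℕ) : ℂ)
      = ∑ x ∈ (univ : Finset (Fin N → Bool)).filter (fun x => Fib19.IsOdd x), (1 / 2 - (1 / 2) * frozenSign τ x u) := by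
    intro u
    rw [winCount_eq_sum]
    refine sum_congr rfl fun x hx => ?_
    rw [win_indicator_eq hN _ x (mem_filter.mp hx).2]
    unfold frozenSign
    ring
  simp_rw [hR]
  -- split the `t = 0` term of the Fourier sum: `fhat 0 = 3^{-m} Σ_u G_x(u)`
  have h0 : ∀ x : Fin N → Bool,
      fhat m (frozenSign τ x) 0 * (ZMod.stdAddChar (∑ l : Fin m, (0 : Fin m → ZMod 3) l * frameVal V x l) : ℂ)
        = ((3 : ℂ) ^ m)⁻¹ * ∑ u : Fin m → ZMod 3, frozenSign τ x u := by
    intro x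
    have hz : (∑ l : Fin m, (0 : Fin m → ZMod 3) l * frameVal V x l) = 0 :=
      sum_eq_zero fun l _ => by simp
    rw [hz, AddChar.map_zero_eq_one, mul_one]
    unfold fhat
    congr 1
    refine sum_congr rfl fun u _ => ?_
    have hz' : (∑ i : Fin m, (0 : Fin m → ZMod 3) i * u i) = 0 := sum_eq_zero fun i _ => by simp
    rw [hz', neg_zero, AddChar.map_zero_eq_one, mul_one]
  have hsplit : ∀ x : Fin N → Bool,
      ∑ t : Fin m → ZMod 3, fhat m (frozenSign τ x) t * (ZMod.stdAddChar (∑ l : Fin m, t l * frameVal V x l) : ℂ)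
        = ((3 : ℂ) ^ m)⁻¹ * (∑ u : Fin m → ZMod 3, frozenSign τ x u)
          + ∑ t ∈ (univ : Finset (Fin m → ZMod 3)).erase 0,
              fhat m (frozenSign τ x) t * (ZMod.stdAddChar (∑ l : Fin m, t l * frameVal V x l) : ℂ) := by
    intro x
    rw [← Finset.add_sum_erase univ _ (mem_univ (0 : Fin m → ZMod 3)), h0]
  simp_rw [hsplit]
  -- bookkeeping
  set O := (univ : Finset (Fin N → Bool)).filter (fun x => Fib19.IsOdd x) with hO
  set E := (univ : Finset (Fin m → ZMod 3)).erase 0 with hE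
  have hcard : (Fintype.card (Fin m → ZMod 3) : ℂ) = (3 : ℂ) ^ m := by
    rw [Fintype.card_fun, ZMod.card, Fintype.card_fin]; push_cast; ring
  have eL : ∑ x ∈ O, (1 / 2 - 1 / 2 * (((3 : ℂ) ^ m)⁻¹ * (∑ u : Fin m → ZMod 3, frozenSign τ x u)
        + ∑ t ∈ E, fhat m (frozenSign τ x) t * (ZMod.stdAddChar (∑ l : Fin m, t l * frameVal V x l) : ℂ)))
      = (∑ _x ∈ O, (1 / 2 : ℂ)) - 1 / 2 * (((3 : ℂ) ^ m)⁻¹ * (∑ x ∈ O, ∑ u : Fin m → ZMod 3, frozenSign τ x u)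
        + ∑ x ∈ O, ∑ t ∈ E, fhat m (frozenSign τ x) t * (ZMod.stdAddChar (∑ l : Fin m, t l * frameVal V x l) : ℂ)) := by
    rw [sum_sub_distrib, ← mul_sum, sum_add_distrib, ← mul_sum]
  have eR : ∑ u : Fin m → ZMod 3, ∑ x ∈ O, (1 / 2 - 1 / 2 * frozenSign τ x u)
      = (3 : ℂ) ^ m * (∑ _x ∈ O, (1 / 2 : ℂ)) - 1 / 2 * ∑ x ∈ O, ∑ u : Fin m → ZMod 3, frozenSign τ x u := by
    simp_rw [sum_sub_distrib, ← mul_sum]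
    rw [sum_const, card_univ, nsmul_eq_mul, hcard,
      sum_comm (s := (univ : Finset (Fin m → ZMod 3))) (t := O)]
  rw [eL, eR, sum_comm (s := E) (t := O)]
  field_simp
  ring

/-- **FRAME DOMINATION with explicit error** (consequence of the identity): for every frame and every table,
`winCount(z) ≤ (Σ_u winCount(z^{[u]}))/3^m + ½ Σ_{t ≠ 0} ‖Σ_{x odd} Ĝ_x(t) ω^{⟨t,Vx⟩}‖`. -/
theorem frame_domination (hN : 3 ≤ N) (V : Fin m → Fin N → ZMod 3)
    (τ : Fin N → (Fin m → ZMod 3) → (Fin N → Bool) → Bool) :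
    (winCount (frameJuntaBell V τ) : ℝ)
      ≤ (∑ u : Fin m → ZMod 3, (winCount (frozenBell τ u) : ℝ)) / (3 : ℝ) ^ m
        + (1 / 2) * ∑ t ∈ (univ : Finset (Fin m → ZMod 3)).erase 0,
            ‖∑ x ∈ (univ : Finset (Fin N → Bool)).filter (fun x => Fib19.IsOdd x),
              fhat m (frozenSign τ x) t * (ZMod.stdAddChar (∑ l : Fin m, t l * frameVal V x l) : ℂ)‖ := by
  have hid := frame_averaging_identity hN V τ
  set S : ℂ := ∑ t ∈ (univ : Finset (Fin m → ZMod 3)).erase 0,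
      ∑ x ∈ (univ : Finset (Fin N → Bool)).filter (fun x => Fib19.IsOdd x),
        fhat m (frozenSign τ x) t * (ZMod.stdAddChar (∑ l : Fin m, t l * frameVal V x l) : ℂ) with hS
  set w : ℝ := (winCount (frameJuntaBell V τ) : ℝ) with hw
  set A : ℝ := (∑ u : Fin m → ZMod 3, (winCount (frozenBell τ u) : ℝ)) / (3 : ℝ) ^ m with hA
  have hwC : ((winCount (frameJuntaBell V τ) : ℕ) : ℂ) = (w : ℂ) := by rw [hw]; push_cast; rfl
  have hAC : (∑ u : Fin m → ZMod 3, ((winCount (frozenBell τ u) : ℕ) : ℂ)) / (3 : ℂ) ^ m = (A : ℂ) := by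
    rw [hA]; push_cast; rfl
  rw [hwC, hAC] at hid
  have hdiff : ((w - A : ℝ) : ℂ) = -(1 / 2) * S := by
    push_cast
    rw [hid]
    ring
  have hnorm : |w - A| = 1 / 2 * ‖S‖ := by
    rw [← Real.norm_eq_abs, ← Complex.norm_real, hdiff, norm_mul, norm_neg]
    norm_num
  have hS_le : ‖S‖ ≤ ∑ t ∈ (univ : Finset (Fin m → ZMod 3)).erase 0,
      ‖∑ x ∈ (univ : Finset (Fin N → Bool)).filter (fun x => Fib19.IsOdd x),
        fhat m (frozenSign τ x) t * (ZMod.stdAddChar (∑ l : Fin m, t l * frameVal V x l) : ℂ)‖ :=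
    norm_sum_le _ _
  have h1 : w - A ≤ |w - A| := le_abs_self _
  linarith

end AffBells22

end Summit.QuantumAdvantage.AdviceFreeQNC0
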